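import Summits.QuantumFields.YangMills.Theorems.LuscherReductionTwistedTraceScalingCovGradInjective
import HarnessLib

/-!
# The linearised slice map `ξ ↦ P_Γ D_u ξ` is a linear EQUIVALENCE `{Σξ = 0} ≃ Γ` for slow variables near `1`, with inverse bounded by the Poincaré constant
# (lane A of S-BASE, crux `TwistedTraceScaling` stmt-QuantumFields-20203, C4 INNER; design note `pub/ym-fleet/ym-luscher-20007-p1/COARSE-DESIGN.md` §23.6/§23.8)

* `gaugeModes_eq_map_meanZero` — `Γ = ∇(meanZero)`: every gauge mode is the gradient of a MEAN-ZERO site field (constants are in the kernel of `∇`);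
* `finrank_meanZero_eq` — `dim {Σξ = 0} = dim Γ` (`∇` is injective on mean-zero fields, `…VacGradKernel`);
* `sliceMap u : meanZero →ₗ Γ`, `ξ ↦ P_Γ(D_u ξ)`; ★★ `sliceMap_bijective` for `|u⃗_k|∞ ≤ τ₀` (injective by `exists_slice_injectivity`, surjective by the dimension count);
* ★★ `sliceEquiv` — the continuous linear equivalence `meanZero ≃L[ℝ] Γ` it defines, with ★ `norm_sliceEquiv_symm_le`: `‖sliceEquiv⁻¹ y‖∞ ≤ C‖y‖`.
This is the invertible derivative block of the inverse-function argument for (N1) «every inner orbit meets the slice `P_Γ relLinkVec = 0`» (the joint map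
`(ξ, w, c) ↦ (P_Γ relLinkVec((orthoTube P(c) w)^{P∘ξ}), w, c)` has block-triangular derivative with this block on the diagonal), and the matrix whose determinant
is the Gaussian value of the Faddeev–Popov weight in (N2).
HONEST FRAMING: finite-dimensional linear algebra for a stub of a child of the CONDITIONAL reduction route R2b1; no spectral claim; C4 OPEN; not a gap, not Clay.
-/

set_option autoImplicit false

noncomputable section

open MeasureTheory Filter Topology Real
open scoped BigOperators Matrix
open Literature.MathematicalPhysics.QuantumFieldTheory
open Literature.MathematicalPhysics.QuantumLattice

namespace Summit.QuantumFields.YangMills.Theorems.FemtoTransferGap.TwoLattice.ConstTube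

open Summit.QuantumFields.YangMills.Theorems.FemtoTransferGap
open Summit.QuantumFields.YangMills.Theorems.FemtoTransferGap.TwoLattice.Stiff (LinkSpace)

variable (L : ℕ) [NeZero L]

/-! ## §1 `Γ = ∇(meanZero)` and the dimension count -/

omit [NeZero L] in
/-- The gradient of a constant site field vanishes. [folklore] -/
theorem vacGrad_const (v : Fin 3 → ℝ) : vacGrad L (fun _ : Site 3 L => v) = 0 := by
  ext ea
  rw [show ea = (ea.1, ea.2) from rfl, vacGrad_apply]
  simp

/-- Subtracting the mean puts a site field in `meanZero` without changing its gradient. [folklore] -/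
theorem sub_mean_mem_meanZero (ξ : Site 3 L → Fin 3 → ℝ) :
    (fun x => ξ x - (Fintype.card (Site 3 L) : ℝ)⁻¹ • ∑ y : Site 3 L, ξ y) ∈ meanZero L := by
  show ∑ x : Site 3 L, (ξ x - (Fintype.card (Site 3 L) : ℝ)⁻¹ • ∑ y : Site 3 L, ξ y) = 0
  have hN : (Fintype.card (Site 3 L) : ℝ) ≠ 0 := by exact_mod_cast Fintype.card_ne_zero
  rw [Finset.sum_sub_distrib, Finset.sum_const, Finset.card_univ, ← Nat.cast_smul_eq_nsmul ℝ, smul_smul, mul_inv_cancel₀ hN, one_smul, sub_self]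

/-- ★ `Γ = ∇(meanZero)`. [folklore] -/
theorem gaugeModes_eq_map_meanZero : gaugeModes L = Submodule.map (vacGrad L) (meanZero L) := by
  refine le_antisymm ?_ LinearMap.map_le_range
  rintro v ⟨ξ, rfl⟩
  refine ⟨_, sub_mean_mem_meanZero L ξ, ?_⟩
  have h : (fun x => ξ x - (Fintype.card (Site 3 L) : ℝ)⁻¹ • ∑ y : Site 3 L, ξ y) =
      ξ - fun _ : Site 3 L => (Fintype.card (Site 3 L) : ℝ)⁻¹ • ∑ y : Site 3 L, ξ y := rfl
  rw [h, map_sub, vacGrad_const, sub_zero]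

/-- The range of `∇` restricted to `meanZero` is `Γ`. [folklore] -/
theorem range_vacGrad_domRestrict : LinearMap.range ((vacGrad L).domRestrict (meanZero L)) = gaugeModes L := by
  rw [LinearMap.range_domRestrict, gaugeModes_eq_map_meanZero]

/-- ★ `dim {Σξ = 0} = dim Γ`. [folklore] -/
theorem finrank_meanZero_eq : Module.finrank ℝ (meanZero L) = Module.finrank ℝ (gaugeModes L) := by
  rw [← range_vacGrad_domRestrict, LinearMap.finrank_range_of_inj (vacGrad_injective_meanZero L)]

/-! ## §2 The slice map and its bijectivity -/

/-- The linearised slice map at slow variable `u`: `ξ ↦ P_Γ(D_u ξ)` from mean-zero site fields to `Γ`. [folklore] -/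
def sliceMap (u : GaugeConfig 3 1 SU2) : meanZero L →ₗ[ℝ] gaugeModes L :=
  ((gaugeModes L).orthogonalProjectionOnto.toLinearMap ∘ₗ covGradL L u) ∘ₗ (meanZero L).subtype

/-- The slice map, coerced to the link space, is `P_Γ(D_u ξ)`. [folklore] -/
theorem coe_sliceMap (u : GaugeConfig 3 1 SU2) (ξ : meanZero L) : (sliceMap L u ξ : LinkSpace L) = (gaugeModes L).starProjection (covGradL L u ξ) := rfl

/-- The injectivity radius and constant of `exists_slice_injectivity`, chosen once. [folklore] -/
theorem sliceData : ∃ p : ℝ × ℝ, 0 < p.1 ∧ 0 < p.2 ∧ p.2 ≤ 1 ∧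
    ∀ u : GaugeConfig 3 1 SU2, (∀ (k : Fin 3) (c : Fin 3), |vecPart (u (0, k)) c| ≤ p.2) →
      ∀ ξ : Site 3 L → Fin 3 → ℝ, ∑ x : Site 3 L, ξ x = 0 → ‖ξ‖ ≤ p.1 * ‖(gaugeModes L).starProjection (covGradL L u ξ)‖ := by
  obtain ⟨C, τ₀, hC, hτ, hτ1, h⟩ := exists_slice_injectivity L
  exact ⟨(C, τ₀), hC, hτ, hτ1, h⟩

/-- The Poincaré-type constant `C_L` of the slice map. [folklore] -/
def sliceConst : ℝ := (sliceData L).choose.1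

/-- The injectivity radius `τ_L` of the slice map. [folklore] -/
def sliceRadius : ℝ := (sliceData L).choose.2

/-- `0 < C_L`. [folklore] -/
theorem sliceConst_pos : 0 < sliceConst L := (sliceData L).choose_spec.1

/-- `0 < τ_L ≤ 1`. [folklore] -/
theorem sliceRadius_pos : 0 < sliceRadius L ∧ sliceRadius L ≤ 1 := ⟨(sliceData L).choose_spec.2.1, (sliceData L).choose_spec.2.2.1⟩

/-- ★ The injectivity inequality with the chosen constants: `‖ξ‖∞ ≤ C_L‖P_Γ(D_u ξ)‖` for `|u⃗_k|∞ ≤ τ_L`, `Σξ = 0`. [folklore] -/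
theorem norm_le_sliceConst_mul {u : GaugeConfig 3 1 SU2} (hu : ∀ (k : Fin 3) (c : Fin 3), |vecPart (u (0, k)) c| ≤ sliceRadius L) (ξ : meanZero L) :
    ‖(ξ : Site 3 L → Fin 3 → ℝ)‖ ≤ sliceConst L * ‖(sliceMap L u ξ : LinkSpace L)‖ :=
  (sliceData L).choose_spec.2.2.2 u hu ξ ξ.2

/-- ★★ **The slice map is bijective** for `|u⃗_k|∞ ≤ τ_L`. [folklore] -/
theorem sliceMap_bijective {u : GaugeConfig 3 1 SU2} (hu : ∀ (k : Fin 3) (c : Fin 3), |vecPart (u (0, k)) c| ≤ sliceRadius L) :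
    Function.Bijective (sliceMap L u) := by
  have hinj : Function.Injective (sliceMap L u) := by
    intro ξ η h
    have hb := norm_le_sliceConst_mul L hu (ξ - η)
    rw [map_sub, h, sub_self, Submodule.coe_zero, norm_zero, mul_zero] at hb
    exact sub_eq_zero.mp (Subtype.ext (norm_le_zero_iff.mp hb) |> fun h0 => by simpa using h0)
  exact ⟨hinj, (LinearMap.injective_iff_surjective_of_finrank_eq_finrank (finrank_meanZero_eq L)).mp hinj⟩

/-- ★★ **THE SLICE EQUIVALENCE** `{Σξ = 0} ≃L[ℝ] Γ`, `ξ ↦ P_Γ(D_u ξ)`, for `|u⃗_k|∞ ≤ τ_L`. [folklore] -/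
def sliceEquiv {u : GaugeConfig 3 1 SU2} (hu : ∀ (k : Fin 3) (c : Fin 3), |vecPart (u (0, k)) c| ≤ sliceRadius L) : meanZero L ≃L[ℝ] gaugeModes L :=
  (LinearEquiv.ofBijective (sliceMap L u) (sliceMap_bijective L hu)).toContinuousLinearEquiv

/-- The slice equivalence acts as the slice map. [folklore] -/
theorem sliceEquiv_apply {u : GaugeConfig 3 1 SU2} (hu : ∀ (k : Fin 3) (c : Fin 3), |vecPart (u (0, k)) c| ≤ sliceRadius L) (ξ : meanZero L) :
    sliceEquiv L hu ξ = sliceMap L u ξ := rfl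

/-- ★ **The inverse is bounded by the Poincaré constant**: `‖sliceEquiv⁻¹ y‖∞ ≤ C_L‖y‖`. [folklore] -/
theorem norm_sliceEquiv_symm_le {u : GaugeConfig 3 1 SU2} (hu : ∀ (k : Fin 3) (c : Fin 3), |vecPart (u (0, k)) c| ≤ sliceRadius L) (y : gaugeModes L) :
    ‖((sliceEquiv L hu).symm y : Site 3 L → Fin 3 → ℝ)‖ ≤ sliceConst L * ‖(y : LinkSpace L)‖ := by
  have h := norm_le_sliceConst_mul L hu ((sliceEquiv L hu).symm y)
  rwa [← sliceEquiv_apply L hu, ContinuousLinearEquiv.apply_symm_apply] at h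

/-- The slice equivalence at `u = 1` (always within the radius): `ξ ↦ P_Γ ∇ξ = ∇ξ`. [folklore] -/
theorem one_mem_sliceRadius : ∀ (k : Fin 3) (c : Fin 3), |vecPart ((1 : GaugeConfig 3 1 SU2) (0, k)) c| ≤ sliceRadius L := fun k c => by
  rw [Pi.one_apply, PolyakovLift.vecPart_one, Pi.zero_apply, abs_zero]; exact (sliceRadius_pos L).1.le

/-- At `u = 1` the slice map is the gradient: `↑(sliceMap 1 ξ) = ∇ξ`. [folklore] -/
theorem coe_sliceMap_one (ξ : meanZero L) : (sliceMap L 1 ξ : LinkSpace L) = vacGrad L ξ := by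
  rw [coe_sliceMap, covGradL_one, proj_vacGrad]

end Summit.QuantumFields.YangMills.Theorems.FemtoTransferGap.TwoLattice.ConstTube

end
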